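import Summits.Langlands.Langlands.Theses.ThreeTorsionCollapse
import Literature.NumberTheory.Automorphic.ThorneQInfinityModularTheorem2Proofs
import Literature.NumberTheory.Automorphic.FLSResidualImageCriteria
import HarnessLib

/-!
# Stub `stub_splitReducibleCore_of_borel` (line `threelocal`, crux `SplitCartanThreeAutomorphic`,
# stmt-Langlands-18556): core R reduced to the sister crux `BorelThreeAutomorphic`

Registered stub of the checked skeleton `Cruxes/SplitCartanThreeAutomorphic/Lines/threelocal.lean`
(lead's reshape, cycle 1).  For `K` totally real and `E / 𝓞 K` with `Δ ≠ 0`: if a framing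
`ρ̄ : Γ_K →ₜ* GL₂(𝔽₃)` of the Galois action on `E[3]` has image in
`N_s(3) = C_s⁺(3) = ⟨diag(1,2), (0 1; 1 0)⟩` and `E[3]` is REDUCIBLE over `K`
(`¬ (E ⊗ K).HasIrreducibleModPGaloisRep 3`), then — GRANTED the sister crux
`Summit.Langlands.Langlands.Theses.ThreeTorsionCollapse.BorelThreeAutomorphic` (item
stmt-Langlands-18557: a framing of `E[3]` with every `(1,0)` entry zero ⇒ `E` automorphic of weight
zero) — `E` is automorphic of weight zero.

Proof (change of framing, three tree lemmas).
1. `¬ HasIrreducibleModPGaloisRep 3` and the dictionary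
   `Thorne2016.hasIrreducibleModPGaloisRep_of_isIrreducible` ("an irreducible framing makes `E[p]`
   irreducible") give `¬ FramedRep.IsIrreducible ρ̄`.
2. `FLS2015.exists_isTorsionGaloisRep_borel_of_not_isIrreducible`: a reducible framing is conjugate
   to an upper-triangular one, i.e. there is a framing `ρ̄'` of `E[3]`
   (`(E ⊗ K).IsTorsionGaloisRep 3 ρ̄'`) with `(ρ̄' σ) 1 0 = 0` for every `σ`.
3. The sister crux, whose framing hypothesis is `WeierstrassCurve.IsTorsionGaloisRep` written out
   and whose conclusion is `IsAutomorphicOfWeightZero E` written out (cone repair rev 1; both agree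
   with the named predicates definitionally), concludes.
The `N_s(3)` hypothesis is not used (the statement is kept in the registered shape of the line).

References: [FreitasLeHungSiksek2015] §4 (residual images at 3); [Thorne2016] proof of Thm. 7.6
(the isogeny/irreducibility dictionary); [Serre1972] §2.
-/

-- project-wide option (lakefile weak.linter.dupNamespace); `Summit.Langlands.Langlands` is mandated
set_option linter.dupNamespace false

noncomputable section

namespace Summit.Langlands.Langlands.Cruxes.SplitCartanThreeAutomorphic.ThreeLocal

open scoped NumberField MatrixGroups Polynomial
open NumberField IsDedekindDomain Filter
open Literature.NumberTheory.Automorphic Literature.NumberTheory.GaloisRepresentations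
open Summit.Langlands.Langlands.Theses.ThreeTorsionCollapse

/-- **Core R reduced to the sister crux** (registered stub `stub_splitReducibleCore_of_borel` of
line `threelocal`, verbatim).  For `K` totally real and `E / 𝓞 K` with `Δ ≠ 0`: if a framing `ρ̄`
of `E[3]` has image in `N_s(3)` and `E[3]` is reducible over `K`
(`¬ (E ⊗ K).HasIrreducibleModPGaloisRep 3`), then, granted `BorelThreeAutomorphic`, `E` is
automorphic of weight zero.  Change of framing: `¬ HasIrreducibleModPGaloisRep 3` makes `ρ̄`
reducible (`Thorne2016.hasIrreducibleModPGaloisRep_of_isIrreducible`), a reducible framing is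
conjugate to an upper-triangular framing `ρ̄'` of `E[3]`
(`FLS2015.exists_isTorsionGaloisRep_borel_of_not_isIrreducible`), and the sister crux applied to
`ρ̄'` concludes (its written-out framing hypothesis and conclusion are the named predicates,
definitionally).  The `N_s(3)` hypothesis is unused by design. [folklore] -/
theorem stub_splitReducibleCore_of_borel : BorelThreeAutomorphic →
    ∀ (K : Type) [Field K] [NumberField K] [IsTotallyReal K] (E : WeierstrassCurve (𝓞 K)),
      E.Δ ≠ 0 → ∀ ρ : FramedGaloisRep K (ZMod 3) 2, (E.baseChange K).IsTorsionGaloisRep 3 ρ →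
        (∀ σ : Field.absoluteGaloisGroup K, (ρ σ : GL (Fin 2) (ZMod 3)) ∈
          Subgroup.closure ({(⟨!![1, 0; 0, 2], !![1, 0; 0, 2], by decide, by decide⟩ :
              GL (Fin 2) (ZMod 3)),
            (⟨!![0, 1; 1, 0], !![0, 1; 1, 0], by decide, by decide⟩ : GL (Fin 2) (ZMod 3))} :
            Set (GL (Fin 2) (ZMod 3)))) →
        ¬ (E.baseChange K).HasIrreducibleModPGaloisRep 3 →
        IsAutomorphicOfWeightZero E := by
  intro hBorel K _ _ _ E hΔ ρ hρ _ hred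
  haveI : Fact (Nat.Prime 3) := ⟨by norm_num⟩
  -- (1) the given framing is not irreducible
  have hnirr : ¬ FramedRep.IsIrreducible ρ := fun hirr =>
    hred (Thorne2016.hasIrreducibleModPGaloisRep_of_isIrreducible hρ hirr)
  -- (2) change of framing: an upper-triangular framing of `E[3]`
  obtain ⟨ρ', hρ', hB⟩ := FLS2015.exists_isTorsionGaloisRep_borel_of_not_isIrreducible hρ hnirr
  -- (3) the sister crux (written-out predicates agree with the named ones definitionally)
  exact hBorel K E hΔ ρ' hρ' hB

end Summit.Langlands.Langlands.Cruxes.SplitCartanThreeAutomorphic.ThreeLocal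

end
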